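import Summits.Ventures.PercRepro.SixFourT4XA

/-!
# PercRepro — C-025 at `(6,4)`, §22.12.3: the covering-pair bound `X ≤ Σ_{(P, P′)} 2^{|P ∩ P′ ∩ G|}` for every
rank-`4` set (p3, gen 9)

mine-2's `MINE2-RLS.md` Lemma 22.12.3 (Lemma X̄, every solid): `X = #{Z ⊆ G : ρ(Z) ≤ 3, ρ(G ∖ Z) ≤ 3}` is at most
the sum, over the ORDERED pairs of distinct planes `(P, P′)` of `M` with `G ⊆ P ∪ P′` (the COVERING PAIRS), of
`2^{|P ∩ P′ ∩ G|}`.  Proof: `Z` lies in a plane `P` and `G ∖ Z` in a plane `P′` (`exists_plane_superset`); then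
`P ≠ P′` (else `ρ(G) ≤ 3`), `G ⊆ P ∪ P′`, and `Z = (G ∖ P′) ∪ (Z ∩ P′)` with `Z ∩ P′ ⊆ P ∩ P′ ∩ G` — so
`Z ↦ (P, P′, Z ∩ P′)` is injective into the disjoint union of the powersets of the `P ∩ P′ ∩ G`.

* `covPairs M G` — the covering pairs;
* `planeOf hG hr Z` — a plane through a rank-`≤ 3` subset `Z ⊆ G` (a choice), with `planeOf_spec`;
* **`Xcnt_le_sum_covPairs`** — the bound.

This is the first piece of the matroid side of §22.12 (`PLBound` of `SixFourPLBridge.lean`); the identification of the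
covering pairs of a plane-line solid with the terms of `Xbar π` is a later file.
-/

namespace PercRepro.SixFour

open Finset ThmH

variable {α : Type*} [DecidableEq α] {M : Matroid α} [M.Finite] {G : Finset α}

/-- The COVERING PAIRS of `G`: ordered pairs of distinct planes of `M` whose union contains `G`. -/
noncomputable def covPairs (M : Matroid α) [M.Finite] (G : Finset α) : Finset (Finset α × Finset α) :=
  (planes M ×ˢ planes M).filter (fun pp => pp.1 ≠ pp.2 ∧ G ⊆ pp.1 ∪ pp.2)

/-- Membership in `covPairs`. -/
theorem mem_covPairs {pp : Finset α × Finset α} :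
    pp ∈ covPairs M G ↔ (pp.1 ∈ planes M ∧ pp.2 ∈ planes M) ∧ pp.1 ≠ pp.2 ∧ G ⊆ pp.1 ∪ pp.2 := by
  unfold covPairs
  rw [Finset.mem_filter, Finset.mem_product]

/-- A plane through a subset `Z ⊆ G` of rank `≤ 3` (any choice; `∅` when the hypotheses fail). -/
noncomputable def planeOf (hG : G ⊆ gr M) (hr : M.eRk (G : Set α) = 4) (Z : Finset α) : Finset α :=
  if h : Z ⊆ G ∧ M.eRk (Z : Set α) ≤ 3 then Classical.choose (exists_plane_superset hG hr h.1 h.2) else ∅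

/-- `planeOf` is a plane containing `Z`. -/
theorem planeOf_spec (hG : G ⊆ gr M) (hr : M.eRk (G : Set α) = 4) {Z : Finset α} (hZ : Z ⊆ G)
    (h3 : M.eRk (Z : Set α) ≤ 3) : planeOf hG hr Z ∈ planes M ∧ Z ⊆ planeOf hG hr Z := by
  unfold planeOf
  rw [dif_pos ⟨hZ, h3⟩]
  exact Classical.choose_spec (exists_plane_superset hG hr hZ h3)

omit [DecidableEq α] in
/-- A rank-`4` set is not contained in a plane. -/
theorem not_subset_plane (hr : M.eRk (G : Set α) = 4) {P : Finset α} (hP : P ∈ planes M) : ¬ G ⊆ P := by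
  intro h
  have := M.eRk_mono (Finset.coe_subset.2 h)
  rw [hr, (mem_planes.1 hP).2.2] at this
  exact absurd this (by decide)

/-- The covering pair of a set `Z` counted by `X`: a plane through `Z` and a plane through `G ∖ Z`. -/
theorem covPair_of_mem_Xset (hG : G ⊆ gr M) (hr : M.eRk (G : Set α) = 4) {Z : Finset α} (hZ : Z ∈ Xset M G) :
    (planeOf hG hr Z, planeOf hG hr (G \ Z)) ∈ covPairs M G := by
  obtain ⟨hZG, hZ3, hZ3'⟩ := mem_Xset.1 hZ
  obtain ⟨hP, hZP⟩ := planeOf_spec hG hr hZG hZ3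
  obtain ⟨hP', hZP'⟩ := planeOf_spec hG hr (Finset.sdiff_subset) hZ3'
  rw [mem_covPairs]
  refine ⟨⟨hP, hP'⟩, ?_, ?_⟩
  · intro heq
    simp only at heq
    apply not_subset_plane hr hP
    intro y hy
    by_cases hyZ : y ∈ Z
    · exact hZP hyZ
    · rw [heq]
      exact hZP' (Finset.mem_sdiff.2 ⟨hy, hyZ⟩)
  · intro y hy
    rw [Finset.mem_union]
    by_cases hyZ : y ∈ Z
    · exact Or.inl (hZP hyZ)
    · exact Or.inr (hZP' (Finset.mem_sdiff.2 ⟨hy, hyZ⟩))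

/-- `Z = (G ∖ P′) ∪ (Z ∩ P′)` when `Z ⊆ G` and `G ∖ Z ⊆ P′`. -/
theorem eq_sdiff_union_inter {Z P' : Finset α} (hZG : Z ⊆ G) (hc : G \ Z ⊆ P') :
    Z = (G \ P') ∪ (Z ∩ P') := by
  ext y
  rw [Finset.mem_union, Finset.mem_sdiff, Finset.mem_inter]
  constructor
  · intro hy
    by_cases hyP : y ∈ P'
    · exact Or.inr ⟨hy, hyP⟩
    · exact Or.inl ⟨hZG hy, hyP⟩
  · rintro (⟨hyG, hyP⟩ | ⟨hy, -⟩)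
    · by_contra hyZ
      exact hyP (hc (Finset.mem_sdiff.2 ⟨hyG, hyZ⟩))
    · exact hy

/-- **Lemma X̄ (22.12.3) for every rank-`4` set**: `X ≤ Σ_{(P, P′) ∈ covPairs} 2^{|P ∩ P′ ∩ G|}`. -/
theorem Xcnt_le_sum_covPairs (hG : G ⊆ gr M) (hr : M.eRk (G : Set α) = 4) :
    Xcnt M G ≤ ∑ pp ∈ covPairs M G, 2 ^ (pp.1 ∩ pp.2 ∩ G).card := by
  classical
  rw [Xcnt_eq_card_Xset]
  -- the target: the disjoint union of the powersets of the `P ∩ P′ ∩ G`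
  have hcard : ((covPairs M G).sigma (fun pp => (pp.1 ∩ pp.2 ∩ G).powerset)).card =
      ∑ pp ∈ covPairs M G, 2 ^ (pp.1 ∩ pp.2 ∩ G).card := by
    rw [Finset.card_sigma]
    exact Finset.sum_congr rfl (fun pp _ => Finset.card_powerset _)
  rw [← hcard]
  refine Finset.card_le_card_of_injOn
    (fun Z => (⟨(planeOf hG hr Z, planeOf hG hr (G \ Z)), Z ∩ planeOf hG hr (G \ Z)⟩ :
      Σ _ : Finset α × Finset α, Finset α)) ?_ ?_
  · intro Z hZ
    rw [Finset.mem_coe] at hZ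
    rw [Finset.mem_coe, Finset.mem_sigma]
    refine ⟨covPair_of_mem_Xset hG hr hZ, ?_⟩
    obtain ⟨hZG, hZ3, hZ3'⟩ := mem_Xset.1 hZ
    obtain ⟨-, hZP⟩ := planeOf_spec hG hr hZG hZ3
    rw [Finset.mem_powerset]
    intro y hy
    rw [Finset.mem_inter] at hy
    rw [Finset.mem_inter, Finset.mem_inter]
    exact ⟨⟨hZP hy.1, hy.2⟩, hZG hy.1⟩
  · intro Z₁ hZ₁ Z₂ hZ₂ heq
    rw [Finset.mem_coe] at hZ₁ hZ₂
    simp only at heq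
    rw [Sigma.mk.inj_iff] at heq
    obtain ⟨h1, h2⟩ := heq
    have h1' : planeOf hG hr (G \ Z₁) = planeOf hG hr (G \ Z₂) := (Prod.mk.inj h1).2
    have h2' : Z₁ ∩ planeOf hG hr (G \ Z₂) = Z₂ ∩ planeOf hG hr (G \ Z₂) := by
      have := eq_of_heq h2
      rwa [h1'] at this
    obtain ⟨hZG₁, -, hZ3₁⟩ := mem_Xset.1 hZ₁
    obtain ⟨hZG₂, -, hZ3₂⟩ := mem_Xset.1 hZ₂
    obtain ⟨-, hc₁⟩ := planeOf_spec hG hr (Finset.sdiff_subset (s := G) (t := Z₁)) hZ3₁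
    obtain ⟨-, hc₂⟩ := planeOf_spec hG hr (Finset.sdiff_subset (s := G) (t := Z₂)) hZ3₂
    rw [eq_sdiff_union_inter hZG₁ hc₁, eq_sdiff_union_inter hZG₂ hc₂, h1', h2']

end PercRepro.SixFour
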